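import Summits.BirchSwinnertonDyer.Rank1Residual.GaloisImage.SakamotoN11InstanceWeil
import Summits.BirchSwinnertonDyer.Rank1Residual.GaloisImage.ResidualTauOfSurj
import HarnessLib

/-!
# Sakamoto 2024 Thm. 4.4 (1) for `(E[3^{k+1}], 𝓕_can)` from surjectivity mod `3` ALONE, and the
# level-one instance (`m = 1`, `T = T̄ = E[3]`) on EVERY surj(3) row — tower or not
# (cell `b2b-bsdres`, team n1011, row T-a3-F1 = N11 instance of the named fact p254540;
# referee-1 CS-1 proviso (1) "the `m = 1` twin from surj(3) alone for the EXOTIC rows"; seat p13)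

HONEST FRAMING (cell `b2b-bsdres`, run/shared/lean/b2b/bsd-rank1-residual/, verbatim in every
file): the goal of the cell is to DELETE the COMBINATION-SHAPED residual classes of the
Birch–Swinnerton-Dyer formula for ALL analytic-rank `≤ 1` elliptic curves over `ℚ` — "full BSD
formula for every rank `≤ 1` curve in class `C`" assembled STRICTLY from published theorems — so
that the rank-`≤ 1` remainder becomes exactly the CONSTRUCTION-SHAPED classes, which are TYPED
(missing-input `Prop`s), NOT attempted. This is not "finishing BSD". Team n1011 (N10/N11, the
additive block `X4 ∧ p = 3`): research route; no claim beyond the stated classes; the label X4 and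
the mark of RESIDUAL-MAP §I N11 are UNCHANGED by this file; nothing is booked. Theorems only: no
definition, no named fact is minted. Every end theorem is CONDITIONAL on the tree's named fact
`Literature.NumberTheory.GaloisCohomology.Sakamoto2024.kolyvaginSystems_freeRankOne_zmod_three_pow`
(R. Sakamoto, JTNB 36 (2024) Thm. 4.4 (1) for `R = ℤ/3^m`, `K = ℚ`; hypothesis `hS24`, debt of the
tree) exactly as n1011-p13's `SakamotoN11Instance.lean` (p255331); the Weil-discharged forms take
Tate's local Euler–Poincaré characteristic (named fact `localEulerPoincareCharacteristic ℚ_v`,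
Milne *ADT* I Thm. 2.8) as the explicit hypothesis `hEP`, as n1011-p18's `…Weil.lean` does.

## What and why

The N11 instance `kolyvaginSystems_freeRankOne_propagatedSelmerStructure` (p255331) and its
Weil-discharged forms `…_weil` / `…_of_towerSurj` (n1011-p18, `SakamotoN11InstanceWeil.lean`) carry
the `3`-ADIC TOWER `htower : ∀ n, ρ̄_{E,3ⁿ} onto`.  Inside p255331 the tower is used for ONE thing
only: surjectivity mod `3`, feeding (H.1) (`residual_irreducible_of_surj`); the (H.2) datum `τ` and
(H.3) are separate binders there.  So the tower is needed only to DISCHARGE `τ` / (H.3) at levels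
`k ≥ 1` (`exists_rootsOfUnityFixer_cokerSubOne_equiv_of_towerSurj`, p04's `hH3_three_of_towerSurj`),
and at level ONE (`k = 0`, `T = E[3]`, `R = 𝔽₃`) everything is available from surj(3) ALONE:
`τ` by p13's `exists_rootsOfUnityFixing_torsion_quotient_equiv_zmod_of_surj` (p252385: `τ ∈ [Γ_ℚ, Γ_ℚ]`
a transvection), (H.3) by n1011-p04's `hH3_of_hasSurjectiveModNGaloisRep W 3 0` (Sah's lemma with
`−1 ∈ im ρ̄_{E,3}`).  This matters on the EXOTIC rows of §I N11 (surj(3) ∧ ¬surj(9): Elkies'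
`9`-deficient `3`-adic image), where the tower and (im) FAIL
(`residualHypotheses_and_not_bigIm_of_exotic`) but the level-one Kolyvagin-system theorem still
applies — the input of row T-a5x (EXOTIC unit case via level-1 Kolyvagin systems).

* `kolyvaginSystems_freeRankOne_propagatedSelmerStructure_of_surj` — p255331 at EVERY level `k`
  with `htower` REPLACED by `h3 : ρ̄_{E,3}` onto (same proof, same remaining binders).
* `kolyvaginSystems_freeRankOne_propagatedSelmerStructure_weil_of_surj` — the same with (H.SD) and
  the residual coisotropy discharged by the Weil choice of `θ` exactly as p18's `…_weil` (binder `hEP`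
  at the finite places of `S`).
* `exists_rootsOfUnityFixer_cokerSubOne_equiv_zmod_three_of_surj` /
  `exists_rootsOfUnityFixer_cokerSubOne_equiv_levelOne_of_surj` — the (H.2) datum at level one from
  surj(3) alone, in the natural spelling (`τ` fixes the roots of unity of EVERY order;
  `E[3]/(τ − 1)E[3] ≃+ ℤ/3`) and in the fact's level-`0` spelling (`((3:ℤ)^0·3`, `3^(0+1)`).
* `kolyvaginSystems_freeRankOne_propagatedSelmerStructure_levelOne_of_surj` — **LEVEL ONE from
  surj(3) alone**: `KS₁(E[3], 𝓕_can, 𝒫(τ))` is free of rank one over `𝔽₃` (and `κ ↦ κ_d` bijective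
  at levels with `λ*(d) = 0`), (H.3) DISCHARGED (p04, `k = 0`, no tower), Weil-discharged; binders:
  `hS24`, `[Finite E[3]]`, `h3`, `τ` (`hτμ`, `hτq` — supplied by the previous theorem), the
  Poitou–Tate family `inv` (four properties), `S` (`hS`, `hS'`, `hunr`), `hEP`, core rank `hCR`,
  the Kolyvagin datum (`D`, `η`, `hP`, `hT`, `hD`).  The sequel `SakamotoN11InstanceLevelOneInputs.lean`
  discharges `hS'`, `hunr` and `hCR` down to (Lp).

What is NOT here: levels `k ≥ 1` without the tower (there (H.2)/(H.3) genuinely need more than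
surj(3) — cf. the EXOTIC obstruction through levels `≥ 2`); any discharge of `hS24`, `hEP`, (Lp),
the Poitou–Tate family or `HasCanonicalComparison`; any class theorem / BSD consequence.

References: R. Sakamoto, JTNB 36 (2024) 919–946, §2 (H.1)–(H.3), Def. 3.5–3.9, Thm. 4.4
[Sakamoto2024]; B. Mazur, K. Rubin, Mem. AMS 799 (2004) §3.5 [MazurRubin2004]; K. Rubin, PCMS 18
(2011) §3.1 [Rubin2011]; J. H. Silverman, *AEC* III.8.1 [SilvermanAEC2009]; J. S. Milne, *ADT* I
Thm. 2.8 [MilneADT2006].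
-/

noncomputable section

open scoped Classical NumberField ContRepresentation
open Field NumberField IsDedekindDomain
open WeierstrassCurve Literature.NumberTheory.EllipticCurves Literature.NumberTheory.GaloisRepresentations
  Literature.NumberTheory.GaloisRepresentations.DiscreteGaloisModule Literature.NumberTheory.GaloisCohomology

namespace Summit.BirchSwinnertonDyer.Rank1Residual.GaloisImage

variable (W : WeierstrassCurve ℚ) [W.IsElliptic]

/-! ### Every level: the tower replaced by surjectivity mod `3` -/

/-- **The N11 instance of Sakamoto's Thm. 4.4 (1) for `(E[3^{k+1}], 𝓕_can)` from surj(3) in place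
of the `3`-adic tower.**  VERBATIM p255331's `kolyvaginSystems_freeRankOne_propagatedSelmerStructure`
(all hypotheses of the fact that are theorems of the tree discharged: Sakamoto's residual pair, the
free `ℤ/3^{k+1}`-module `E[3^{k+1}]`, (H.1), cartesian at every place, `𝓕̄ = propagatedSelmerStructureOne`)
except that the binder `htower : ∀ n, ρ̄_{E,3ⁿ} onto` is REPLACED by `h3 : ρ̄_{E,3} onto` — inside
p255331 the tower served only (H.1).  Remaining explicit binders unchanged: `τ` (`hτμ`, `hτq`), (H.3)
`hH3`, `θ`/`hθ`, the Poitou–Tate family, `S`, `hunr`, core rank `hCR`, coisotropy `hco`, the datum.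
CONDITIONAL on the named fact `hS24`. [cite: Sakamoto2024, Thm. 4.4 (p. 926)] -/
theorem kolyvaginSystems_freeRankOne_propagatedSelmerStructure_of_surj
    (hS24 : Sakamoto2024.kolyvaginSystems_freeRankOne_zmod_three_pow) (k : ℕ)
    [Finite (geomTorsion W ((3 : ℕ) : ℤ))] [Finite (geomTorsion W (((3 : ℕ) : ℤ) ^ k * ((3 : ℕ) : ℤ)))]
    (h3 : W.HasSurjectiveModNGaloisRep ((3 : ℕ) : ℤ))
    (τ : absoluteGaloisGroup ℚ) (hτμ : τ ∈ rootsOfUnityFixer ℚ (3 ^ (k + 1)))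
    (hτq : Nonempty (cokerSubOne (W.torsionGaloisModule (((3 : ℕ) : ℤ) ^ k * ((3 : ℕ) : ℤ))) τ ≃+
      ZMod (3 ^ (k + 1))))
    (hH3 : ∀ f : contOneCocycles (W.torsionGaloisModule ((3 : ℕ) : ℤ)).toTopRep,
      (∀ u : absoluteGaloisGroup ℚ, (W.torsionGaloisModule (((3 : ℕ) : ℤ) ^ k * ((3 : ℕ) : ℤ))) u = 1 →
        u ∈ rootsOfUnityFixer ℚ (3 ^ (k + 1)) → f.1 u = 0) →
        oneCocycleClass (W.torsionGaloisModule ((3 : ℕ) : ℤ)).toTopRep f = 0)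
    (θ : (W.torsionGaloisModule ((3 : ℕ) : ℤ)).toContRepresentation →ⁱL
      ((W.torsionGaloisModule ((3 : ℕ) : ℤ)).tateDual 3).toContRepresentation)
    (hθ : Function.Bijective θ)
    (inv : LocalInvariants ℚ 3) (hperf : inv.IsPerfect) (hsum : inv.SumLocalTermEqZero)
    (hunro : inv.UnramifiedOrthogonal) (hcompl : inv.SelmerComplement)
    (S : Finset (Place ℚ)) (hS : ∀ w : InfinitePlace ℚ, (Sum.inl w : Place ℚ) ∈ S)
    (hS' : ∀ v : HeightOneSpectrum (𝓞 ℚ), (Sum.inr v : Place ℚ) ∉ S →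
      ((3 : ℕ) : 𝓞 ℚ) ∉ v.asIdeal ∧ GaloisRep.IsUnramifiedAt v (W.torsionGaloisModule (((3 : ℕ) : ℤ) ^ k * ((3 : ℕ) : ℤ))))
    (hunr : (propagatedSelmerStructure W 3 k).IsUnramifiedOutside S)
    (hCR : LocalInvariants.HasCoreRank inv (propagatedSelmerStructureOne W 3) 3 1)
    (hco : inv.IsResiduallyCoisotropic (propagatedSelmerStructureOne W 3) θ S)
    (D : KolyvaginDatum (W.torsionGaloisModule (((3 : ℕ) : ℤ) ^ k * ((3 : ℕ) : ℤ))))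
    (η : (q : HeightOneSpectrum (𝓞 ℚ)) → (ZMod (Ideal.absNorm q.asIdeal))ˣ)
    (hP : D.primes = frobeniusClassPrimes (W.torsionGaloisModule (((3 : ℕ) : ℤ) ^ k * ((3 : ℕ) : ℤ)))
      {v | (Sum.inr v : Place ℚ) ∈ S} τ (3 ^ (k + 1)))
    (hT : D.transverse = cyclotomicTransverse (W.torsionGaloisModule (((3 : ℕ) : ℤ) ^ k * ((3 : ℕ) : ℤ))))
    (hD : D.HasCanonicalComparison (3 ^ (k + 1)) η) :
    KolyvaginSystem.IsFreeRankOneZMod (D.kolyvaginSystems (propagatedSelmerStructure W 3 k))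
        (3 ^ (k + 1)) ∧
      ∀ (d : Finset (HeightOneSpectrum (𝓞 ℚ))) (hd : D.IsLevel d),
        LocalInvariants.lambdaStar inv ((D.atLevel (propagatedSelmerStructure W 3 k) d).induced
          (W.torsionMulBy (((3 : ℕ) : ℤ) ^ k) ((3 : ℕ) : ℤ))) 3 = 0 →
        Function.Bijective fun κ : D.kolyvaginSystems (propagatedSelmerStructure W 3 k) =>
          (⟨κ.1 d, ((KolyvaginDatum.mem_kolyvaginSystems_iff D _ κ.1).mp κ.2).mem_selmerGroup
              d hd⟩ : (D.atLevel (propagatedSelmerStructure W 3 k) d).selmerGroup) := by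
  haveI : NeZero ((3 : ℕ) : ℚ) := ⟨by norm_num⟩
  have hcart := isCartesian_propagatedSelmerStructure W 3 k S
  have hCR' : LocalInvariants.HasCoreRank inv
      ((propagatedSelmerStructure W 3 k).induced (W.torsionMulBy (((3 : ℕ) : ℤ) ^ k) ((3 : ℕ) : ℤ))) 3 1 := by
    rw [induced_propagatedSelmerStructure]; exact hCR
  have hco' : inv.IsResiduallyCoisotropic
      ((propagatedSelmerStructure W 3 k).induced (W.torsionMulBy (((3 : ℕ) : ℤ) ^ k) ((3 : ℕ) : ℤ))) θ S := by
    rw [induced_propagatedSelmerStructure]; exact hco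
  exact hS24 (geomTorsion W (((3 : ℕ) : ℤ) ^ k * ((3 : ℕ) : ℤ))) (geomTorsion W ((3 : ℕ) : ℤ)) (k + 1)
    (W.torsionGaloisModule _) (W.torsionGaloisModule _) (W.torsionMulBy (((3 : ℕ) : ℤ) ^ k) ((3 : ℕ) : ℤ))
    (W.torsionInclusion (Dvd.intro_left _ rfl)) τ θ inv S (propagatedSelmerStructure W 3 k) D η
    (torsionMulBy_pow_surjective W 3 k) (torsionMulBy_pow_eq_zero_iff W 3 k)
    (torsionInclusion_torsionMulBy_pow W 3 k) (residual_irreducible_of_surj W 3 h3) hτμ hτq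
    hH3 hθ hperf hsum hunro hcompl hS hS' hunr hcart hCR' hco' hP hT hD

/-- **Every level, from surj(3), with (H.SD) and the residual coisotropy DISCHARGED** (`θ :=` the
Weil dual map of a Weil pairing on `E[3]`, exactly as n1011-p18's
`kolyvaginSystems_freeRankOne_propagatedSelmerStructure_weil`; price: Tate's local Euler–Poincaré
characteristic `hEP` at the finite places of `S`; `[Finite E[3^k·3]]` discharged by
`finite_geomTorsion_pow_mul`).  Binders: `hS24`, `k`, `[Finite E[3]]`, `h3`, `τ` (`hτμ`, `hτq`),
`hH3`, `inv` ×4, `S` (`hS`, `hS'`, `hunr`), `hEP`, `hCR`, the datum.  CONDITIONAL on `hS24`.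
[cite: Sakamoto2024, Def. 3.8 (p. 924) and Thm. 4.4 (p. 926)] -/
theorem kolyvaginSystems_freeRankOne_propagatedSelmerStructure_weil_of_surj
    (hS24 : Sakamoto2024.kolyvaginSystems_freeRankOne_zmod_three_pow) (k : ℕ)
    [Finite (geomTorsion W ((3 : ℕ) : ℤ))]
    (h3 : W.HasSurjectiveModNGaloisRep ((3 : ℕ) : ℤ))
    (τ : absoluteGaloisGroup ℚ) (hτμ : τ ∈ rootsOfUnityFixer ℚ (3 ^ (k + 1)))
    (hτq : Nonempty (cokerSubOne (W.torsionGaloisModule (((3 : ℕ) : ℤ) ^ k * ((3 : ℕ) : ℤ))) τ ≃+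
      ZMod (3 ^ (k + 1))))
    (hH3 : ∀ f : contOneCocycles (W.torsionGaloisModule ((3 : ℕ) : ℤ)).toTopRep,
      (∀ u : absoluteGaloisGroup ℚ, (W.torsionGaloisModule (((3 : ℕ) : ℤ) ^ k * ((3 : ℕ) : ℤ))) u = 1 →
        u ∈ rootsOfUnityFixer ℚ (3 ^ (k + 1)) → f.1 u = 0) →
        oneCocycleClass (W.torsionGaloisModule ((3 : ℕ) : ℤ)).toTopRep f = 0)
    (inv : LocalInvariants ℚ 3) (hperf : inv.IsPerfect) (hsum : inv.SumLocalTermEqZero)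
    (hunro : inv.UnramifiedOrthogonal) (hcompl : inv.SelmerComplement)
    (S : Finset (Place ℚ)) (hS : ∀ w : InfinitePlace ℚ, (Sum.inl w : Place ℚ) ∈ S)
    (hS' : ∀ v : HeightOneSpectrum (𝓞 ℚ), (Sum.inr v : Place ℚ) ∉ S →
      ((3 : ℕ) : 𝓞 ℚ) ∉ v.asIdeal ∧ GaloisRep.IsUnramifiedAt v
        (W.torsionGaloisModule (((3 : ℕ) : ℤ) ^ k * ((3 : ℕ) : ℤ))))
    (hunr : (propagatedSelmerStructure W 3 k).IsUnramifiedOutside S)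
    (hEP : ∀ v : HeightOneSpectrum (𝓞 ℚ), (Sum.inr v : Place ℚ) ∈ S →
      localEulerPoincareCharacteristic (v.adicCompletion ℚ))
    (hCR : LocalInvariants.HasCoreRank inv (propagatedSelmerStructureOne W 3) 3 1)
    (D : KolyvaginDatum (W.torsionGaloisModule (((3 : ℕ) : ℤ) ^ k * ((3 : ℕ) : ℤ))))
    (η : (q : HeightOneSpectrum (𝓞 ℚ)) → (ZMod (Ideal.absNorm q.asIdeal))ˣ)
    (hP : D.primes = frobeniusClassPrimes (W.torsionGaloisModule (((3 : ℕ) : ℤ) ^ k * ((3 : ℕ) : ℤ)))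
      {v | (Sum.inr v : Place ℚ) ∈ S} τ (3 ^ (k + 1)))
    (hT : D.transverse =
      cyclotomicTransverse (W.torsionGaloisModule (((3 : ℕ) : ℤ) ^ k * ((3 : ℕ) : ℤ))))
    (hD : D.HasCanonicalComparison (3 ^ (k + 1)) η) :
    KolyvaginSystem.IsFreeRankOneZMod (D.kolyvaginSystems (propagatedSelmerStructure W 3 k))
        (3 ^ (k + 1)) ∧
      ∀ (d : Finset (HeightOneSpectrum (𝓞 ℚ))) (hd : D.IsLevel d),
        LocalInvariants.lambdaStar inv ((D.atLevel (propagatedSelmerStructure W 3 k) d).induced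
          (W.torsionMulBy (((3 : ℕ) : ℤ) ^ k) ((3 : ℕ) : ℤ))) 3 = 0 →
        Function.Bijective fun κ : D.kolyvaginSystems (propagatedSelmerStructure W 3 k) =>
          (⟨κ.1 d, ((KolyvaginDatum.mem_kolyvaginSystems_iff D _ κ.1).mp κ.2).mem_selmerGroup
              d hd⟩ : (D.atLevel (propagatedSelmerStructure W 3 k) d).selmerGroup) := by
  haveI := finite_geomTorsion_pow_mul W 3 k
  obtain ⟨e, hμ, hadd₁, hadd₂, halt, hnondeg, hgal⟩ :=
    exists_weilPairing_holds W 3 (by norm_num) (by norm_num)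
  exact kolyvaginSystems_freeRankOne_propagatedSelmerStructure_of_surj W hS24 k h3 τ hτμ hτq hH3
    (weilDualIntertwining W 3 e hμ hadd₁ hadd₂ hgal)
    (X11b.LocBridge.weilDualHom_bijective W 3 e hμ hadd₁ hadd₂ hnondeg)
    inv hperf hsum hunro hcompl S hS hS' hunr hCR
    (isResiduallyCoisotropic_propagatedSelmerStructureOne_three W e hμ hadd₁ hadd₂ hgal halt hnondeg
      inv hperf S hEP)
    D η hP hT hD

/-! ### The (H.2) datum at level one from surjectivity mod `3` alone -/

/-- **(H.2) for `(E[3], 𝔽₃)` from surj(3) ALONE, natural spelling:** there is `τ ∈ Γ_ℚ` fixing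
the roots of unity of EVERY order `N ≥ 1` (`τ ∈ [Γ_ℚ, Γ_ℚ]`, p252385
`exists_rootsOfUnityFixing_torsion_quotient_equiv_zmod_of_surj`) with `E[3]/(τ − 1)E[3] ≃+ ℤ/3`, in
the fact's `cokerSubOne` spelling on `W.torsionGaloisModule 3`.  No tower.
[cite: Sakamoto2024, §2 hypothesis (H.2) (p. 921)] -/
theorem exists_rootsOfUnityFixer_cokerSubOne_equiv_zmod_three_of_surj
    (h3 : W.HasSurjectiveModNGaloisRep ((3 : ℕ) : ℤ)) :
    ∃ τ : absoluteGaloisGroup ℚ, (∀ N : ℕ, N ≠ 0 → τ ∈ rootsOfUnityFixer ℚ N) ∧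
      Nonempty (cokerSubOne (W.torsionGaloisModule ((3 : ℕ) : ℤ)) τ ≃+ ZMod 3) := by
  haveI : Fact (Nat.Prime 3) := ⟨Nat.prime_three⟩
  obtain ⟨τ, hτ, hq⟩ :=
    exists_rootsOfUnityFixing_torsion_quotient_equiv_zmod_of_surj W 3 (by decide) h3
  refine ⟨τ, fun N hN => mem_rootsOfUnityFixer_iff.mpr (hτ N hN), ?_⟩
  have hf : ((W.torsionGaloisModule ((3 : ℕ) : ℤ)) τ).toAddMonoidHom =
      (Multiplicative.toAdd (galoisRepTorsion W ((3 : ℕ) : ℤ) τ)).toAddMonoidHom :=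
    AddMonoidHom.ext fun x => by
      rw [LinearMap.toAddMonoidHom_coe, torsionGaloisModule_apply_apply]; rfl
  change Nonempty (geomTorsion W _ ⧸ (((W.torsionGaloisModule _) τ).toAddMonoidHom -
    AddMonoidHom.id _).range ≃+ _)
  rw [hf]
  exact hq

/-- **(H.2) at level one from surj(3) ALONE, in the level-`0` spelling of the fact's instance**
(`T = E[3^0·3]`, `R = ℤ/3^(0+1)`): `∃ τ ∈ Gal(ℚ̄/ℚ(μ₃))` with `E[3^0·3]/(τ − 1) ≃+ ℤ/3^1` — exactly
the binders `hτμ`, `hτq` of `kolyvaginSystems_freeRankOne_propagatedSelmerStructure_levelOne_of_surj`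
below (use `obtain ⟨τ, hτμ, hτq⟩ := …`).  No tower. [cite: Sakamoto2024, §2 hypothesis (H.2) (p. 921)] -/
theorem exists_rootsOfUnityFixer_cokerSubOne_equiv_levelOne_of_surj
    (h3 : W.HasSurjectiveModNGaloisRep ((3 : ℕ) : ℤ)) :
    ∃ τ : absoluteGaloisGroup ℚ, τ ∈ rootsOfUnityFixer ℚ (3 ^ (0 + 1)) ∧
      Nonempty (cokerSubOne (W.torsionGaloisModule (((3 : ℕ) : ℤ) ^ 0 * ((3 : ℕ) : ℤ))) τ ≃+
        ZMod (3 ^ (0 + 1))) := by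
  obtain ⟨τ, hτ, hq⟩ := exists_rootsOfUnityFixer_cokerSubOne_equiv_zmod_three_of_surj W h3
  refine ⟨τ, hτ _ (by norm_num), ?_⟩
  have hlevel : ((3 : ℕ) : ℤ) ^ 0 * ((3 : ℕ) : ℤ) = ((3 : ℕ) : ℤ) := by rw [pow_zero, one_mul]
  rw [hlevel]
  simpa using hq

/-! ### Level one (`m = 1`, `T = T̄ = E[3]`) from surjectivity mod `3` alone -/

/-- **The level-one N11 instance of Sakamoto's Thm. 4.4 (1) from surj(3) ALONE — no tower.**  For
`E/ℚ` with `ρ̄_{E,3}` onto, `T = T̄ = E[3]` (the fact's level `k = 0`: `E[3^0·3]`, `R = ℤ/3^1 = 𝔽₃`)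
and `𝓕_can = propagatedSelmerStructure W 3 0` (whose residual structure is
`propagatedSelmerStructureOne W 3`): `KS₁(E[3], 𝓕_can, 𝒫(τ))` is free of rank one over `𝔽₃`, and
`κ ↦ κ_d` is bijective at every level `d` with `λ*(d) = 0`.  DISCHARGED here beyond
`…_weil_of_surj`: (H.3) at level one by n1011-p04's `hH3_of_hasSurjectiveModNGaloisRep W 3 0`
(`−1 ∈ im ρ̄_{E,3}`, Sah; NO tower).  Binders left explicit (nothing hidden): the fact `hS24`,
`[Finite E[3]]`, `h3`, the (H.2) datum `τ` with `hτμ`, `hτq` (which EXISTS by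
`exists_rootsOfUnityFixer_cokerSubOne_equiv_levelOne_of_surj`; data because Sakamoto's primes
depend on it), the Poitou–Tate family `inv` ×4, `S` with `hS`, `hS'`, `hunr`, Tate's `hEP` on the
finite places of `S`, the core rank `hCR`, and the Kolyvagin datum `D`, `η`, `hP`, `hT`, `hD`.
This is referee-1's proviso (1) "m = 1 twin": it applies on EVERY surj(3) row of N11, in
particular on the EXOTIC rows (surj(3) ∧ ¬surj(9)) where the tower / (im) fails
(`residualHypotheses_and_not_bigIm_of_exotic`).  CONDITIONAL on `hS24`; nothing booked, no mark
changed. [cite: Sakamoto2024, §2 (H.1)–(H.3) (p. 921) and Thm. 4.4 (p. 926)] -/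
theorem kolyvaginSystems_freeRankOne_propagatedSelmerStructure_levelOne_of_surj
    (hS24 : Sakamoto2024.kolyvaginSystems_freeRankOne_zmod_three_pow)
    [Finite (geomTorsion W ((3 : ℕ) : ℤ))]
    (h3 : W.HasSurjectiveModNGaloisRep ((3 : ℕ) : ℤ))
    (τ : absoluteGaloisGroup ℚ) (hτμ : τ ∈ rootsOfUnityFixer ℚ (3 ^ (0 + 1)))
    (hτq : Nonempty (cokerSubOne (W.torsionGaloisModule (((3 : ℕ) : ℤ) ^ 0 * ((3 : ℕ) : ℤ))) τ ≃+
      ZMod (3 ^ (0 + 1))))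
    (inv : LocalInvariants ℚ 3) (hperf : inv.IsPerfect) (hsum : inv.SumLocalTermEqZero)
    (hunro : inv.UnramifiedOrthogonal) (hcompl : inv.SelmerComplement)
    (S : Finset (Place ℚ)) (hS : ∀ w : InfinitePlace ℚ, (Sum.inl w : Place ℚ) ∈ S)
    (hS' : ∀ v : HeightOneSpectrum (𝓞 ℚ), (Sum.inr v : Place ℚ) ∉ S →
      ((3 : ℕ) : 𝓞 ℚ) ∉ v.asIdeal ∧ GaloisRep.IsUnramifiedAt v
        (W.torsionGaloisModule (((3 : ℕ) : ℤ) ^ 0 * ((3 : ℕ) : ℤ))))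
    (hunr : (propagatedSelmerStructure W 3 0).IsUnramifiedOutside S)
    (hEP : ∀ v : HeightOneSpectrum (𝓞 ℚ), (Sum.inr v : Place ℚ) ∈ S →
      localEulerPoincareCharacteristic (v.adicCompletion ℚ))
    (hCR : LocalInvariants.HasCoreRank inv (propagatedSelmerStructureOne W 3) 3 1)
    (D : KolyvaginDatum (W.torsionGaloisModule (((3 : ℕ) : ℤ) ^ 0 * ((3 : ℕ) : ℤ))))
    (η : (q : HeightOneSpectrum (𝓞 ℚ)) → (ZMod (Ideal.absNorm q.asIdeal))ˣ)
    (hP : D.primes = frobeniusClassPrimes (W.torsionGaloisModule (((3 : ℕ) : ℤ) ^ 0 * ((3 : ℕ) : ℤ)))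
      {v | (Sum.inr v : Place ℚ) ∈ S} τ (3 ^ (0 + 1)))
    (hT : D.transverse =
      cyclotomicTransverse (W.torsionGaloisModule (((3 : ℕ) : ℤ) ^ 0 * ((3 : ℕ) : ℤ))))
    (hD : D.HasCanonicalComparison (3 ^ (0 + 1)) η) :
    KolyvaginSystem.IsFreeRankOneZMod (D.kolyvaginSystems (propagatedSelmerStructure W 3 0))
        (3 ^ (0 + 1)) ∧
      ∀ (d : Finset (HeightOneSpectrum (𝓞 ℚ))) (hd : D.IsLevel d),
        LocalInvariants.lambdaStar inv ((D.atLevel (propagatedSelmerStructure W 3 0) d).induced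
          (W.torsionMulBy (((3 : ℕ) : ℤ) ^ 0) ((3 : ℕ) : ℤ))) 3 = 0 →
        Function.Bijective fun κ : D.kolyvaginSystems (propagatedSelmerStructure W 3 0) =>
          (⟨κ.1 d, ((KolyvaginDatum.mem_kolyvaginSystems_iff D _ κ.1).mp κ.2).mem_selmerGroup
              d hd⟩ : (D.atLevel (propagatedSelmerStructure W 3 0) d).selmerGroup) :=
  haveI : Fact (Nat.Prime 3) := ⟨Nat.prime_three⟩
  kolyvaginSystems_freeRankOne_propagatedSelmerStructure_weil_of_surj W hS24 0 h3 τ hτμ hτq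
    (hH3_of_hasSurjectiveModNGaloisRep W 3 0 (by decide)
      (by simpa only [pow_zero, one_mul] using h3))
    inv hperf hsum hunro hcompl S hS hS' hunr hEP hCR D η hP hT hD

end Summit.BirchSwinnertonDyer.Rank1Residual.GaloisImage

end
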